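import Mathlib
import HarnessLib
import Literature.Probability.MarkovChains.PeskunOrdering
import Literature.Probability.MarkovChains.SpectralGapVariational
import Literature.Probability.MarkovChains.ErgodicSumVariance

/-!
# Vorticity: adding a skew-symmetric circulation to a reversible chain keeps `π` invariant and never increases the asymptotic variance (Sun–Gomez–Schmidhuber 2010; Bierkens 2016, Lemma 2.1 and Proposition 3.1)

HONEST FRAMING: exact (Metropolis-corrected) sampling algorithms for lattice gauge theory; figures
of merit are autocorrelation/cost numbers at stated couplings and volumes; no continuum-physics claim.

Conventions of `PeskunOrdering.lean`: finite `X`, `π : X → ℝ` a positive probability vector, ROW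
transition matrices `P : Matrix X X ℝ` (`IsRowStochastic`, `IsStationary π P`, `DetailedBalance π P`,
`IsIrreducible`), `piInner π g h = ⟨g,h⟩_π`, `dirichletForm π P u = 𝓔_P(u)`, `centred π f = f̄`,
`limitMatrix π = A`, `fundamentalMatrix π P = Z = (I − (P − A))⁻¹`, and the ASYMPTOTIC VARIANCE
`asympVar f π P = v(f, π, P) = lim_N N⁻¹var[Σ_{t≤N} f(X_t)]` (Kemeny–Snell's closed form, whose limit
meaning `tendsto_varSum_div` is proved there for every IRREDUCIBLE `P`, reversible or not).  Source:
J. Bierkens, *Non-reversible Metropolis–Hastings*, Stat. Comput. 26 (2016) 1213–1228 (online 2015)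
[Bierkens2015], §2.1 and §3.1 (held: `paper:arxiv-1401.8087`, pp. 4, 7), which restates the
finite-state result of Y. Sun, F. Gomez, J. Schmidhuber, *Improving the asymptotic performance of
Markov chain Monte-Carlo by inserting vortices*, NIPS 2010 [SunGomezSchmidhuber2010] and of
T.-L. Chen, C.-R. Hwang, *Accelerating reversible Markov chains*, Statist. Probab. Lett. 83 (2013)
[ChenHwang2013] ("The following result is obtained in [Sun2010], for a more extensive argument see
[Chen2013]").  Everything below is PROVED (finite sums and the tree's fundamental-matrix calculus;
0 named facts).

* `vorticityOf π P = Γ`, `Γ(x,y) := π(x)P(x,y) − π(y)P(y,x)` [cite: Bierkens2015, §2.1 eq. (1)];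
  **LEMMA 2.1** [cite: Bierkens2015, §2.1 Lemma 2.1]: (i) `vorticityOf_swap` — `Γ` is
  skew-symmetric; (ii) `vorticityOf_eq_zero_iff` — `π` satisfies detailed balance w.r.t. `P` iff
  `Γ = 0`; (iii) `isStationary_iff_vorticityOf_rowSum` — `π` is invariant for `P` iff `Γ1 = 0`
  (for a row-stochastic `P`: `(Γ1)(x) = π(x) − Σ_y π(y)P(y,x)`, `vorticityOf_rowSum`).
* `IsVorticity Γ` — "a matrix `Γ` which is skew-symmetric and satisfies `Γ1 = 0` is called a
  vorticity matrix" [cite: Bierkens2015, §2.1 (definition after Lemma 2.1)]; `IsVorticity.colSum`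
  (`1ᵀΓ = 0` as well); `isVorticity_vorticityOf` (the vorticity of a stationary pair is one).
* `addVorticity K π Γ = P`, `P(x,y) := K(x,y) + Γ(x,y)/(2π(x))` — "a direct way of constructing a
  non-reversible chain `P` from a reversible chain `K` and a vorticity matrix `Γ`"
  [cite: Bierkens2015, §2.1 Remark 2.2] [cite: SunGomezSchmidhuber2010, §3]; for a positive `π`,
  reversible `K` and a vorticity matrix `Γ` (non-negativity of `P` is the printed proviso "provided
  that `P` is a probability matrix", carried as a hypothesis where needed): `addVorticity_rowSum`
  (rows sum to `1`), `addVorticity_isRowStochastic`, **`addVorticity_isStationary` (`πP = π`)**,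
  `vorticityOf_addVorticity` (**the vorticity of `(P, π)` is `Γ`**), `addVorticity_detailedBalance_iff`
  (`P` is reversible iff `Γ = 0`), and the key identity **`dirichletForm_addVorticity`:
  `𝓔_P(u) = 𝓔_K(u)` for every `u`** — the Dirichlet form does not see the circulation
  (`Σ_{x,y} Γ(x,y)(u(x) − u(y))² = 0` by skew-symmetry) [cite: Bierkens2015, §3.2 ("Since `Γ` is
  skew-symmetric, the second term vanishes")].
* **PROPOSITION 3.1** [cite: Bierkens2015, §3.1 Prop. 3.1] [cite: SunGomezSchmidhuber2010, §3]
  [cite: ChenHwang2013, Thm 1]: let `K` be irreducible and reversible with positive stationary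
  probability vector `π`, `Γ` a vorticity matrix, and `P = K + ½diag(π)⁻¹Γ` the transition matrix
  of an irreducible chain (entries `≥ 0`).  Then **`Bierkens2015_prop_3_1`: `v(f, π, P) ≤ v(f, π, K)`
  for EVERY `f`** ("adding non-reversibility decreases asymptotic variance"), and
  **`Bierkens2015_prop_3_1_strict`: if `Γ ≠ 0` (and `|X| ≥ 2`) there is an `f` with
  `v(f, π, P) < v(f, π, K)`**.  PROOF ROUTE (declared; the sources argue through the resolvent):
  the variational calculus of `PeskunOrdering.lean` — for the centred `g = f̄`,
  `v(f,P) = 2⟨g, Z_P g⟩_π − ‖g‖²_π` (`asympVar_eq_centred`, valid for the non-reversible `P`),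
  `⟨g, Z_P g⟩_π = 2⟨g, Z_P g⟩_π − 𝓔_P(Z_P g)` (`variational_eq`, any stationary `P`)
  `= 2⟨g, Z_P g⟩_π − 𝓔_K(Z_P g) ≤ ⟨g, Z_K g⟩_π` (`dirichletForm_addVorticity`, then Bellman's
  inequality `variational_le` for the REVERSIBLE `K`); the deficit is exactly
  `v(f,K) − v(f,P) = 2𝓔_K(Z_K f̄ − Z_P f̄)` (`asympVar_sub_asympVar_addVorticity`), which for
  `f = h − Kh` with `Γh ≠ 0` is `> 0` because `Z_K f̄ − Z_P f̄` is centred and non-zero and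
  `𝓔_K ≥ γ‖·‖²_π` on centred functions with `γ > 0` (Lemma 13.7 and `spectralGap_pos` of the tree).

NOT CLAIMED: the large-deviation comparison `I_P ≥ I_K` [Bierkens2015, §3.2 Prop. 3.2]; the
non-reversible Metropolis–Hastings construction `P_Γ` itself [Bierkens2015, §2.3 Thm 2.5] (a
Hastings ratio with `Γ` inserted); continuous state spaces (§4); that the irreducibility of `P`
assumed in Prop. 3.1 is automatic.

Context (cell pub-lqcd, venture LatticeQCDFlow): with `LiftingMixingTimeBounds.lean` (lifting) this
is the second of the "two basic approaches to the construction of non-reversible chains from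
reversible chains" [Bierkens2015, §1]; both are exact (`π` stays invariant: here by `Γ1 = 0`, the
skew detailed balance of the physics literature), and this one provably never loses in asymptotic
variance — the figure of merit `Var·2τ_int` of the cell's fitness function — while its Dirichlet
form, hence every conductance / `Gap_R` bound of the tree, is that of the reversible part.
-/

namespace Literature.Probability.MarkovChains

open Finset Matrix

variable {X : Type*} [Fintype X] [DecidableEq X]

/-! ## The vorticity of a pair `(P, π)` and Lemma 2.1 -/

/-- The VORTICITY of the pair `(P, π)`: `Γ(x,y) := π(x)P(x,y) − π(y)P(y,x)` ("(essentially) the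
skew-symmetric part of `P`"). [cite: Bierkens2015, §2.1 eq. (1)] -/
def vorticityOf (π : X → ℝ) (P : Matrix X X ℝ) : Matrix X X ℝ :=
  Matrix.of fun x y => π x * P x y - π y * P y x

omit [Fintype X] [DecidableEq X] in
/-- Entry formula. [cite: Bierkens2015, §2.1 eq. (1)] -/
theorem vorticityOf_apply (π : X → ℝ) (P : Matrix X X ℝ) (x y : X) :
    vorticityOf π P x y = π x * P x y - π y * P y x := rfl

omit [Fintype X] [DecidableEq X] in
/-- **Lemma 2.1 (i)**: `Γ` is skew-symmetric, `Γ(y,x) = −Γ(x,y)`. [cite: Bierkens2015, §2.1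
Lemma 2.1 (i)] -/
theorem vorticityOf_swap (π : X → ℝ) (P : Matrix X X ℝ) (x y : X) :
    vorticityOf π P y x = -vorticityOf π P x y := by
  simp only [vorticityOf_apply]; ring

omit [Fintype X] [DecidableEq X] in
/-- **Lemma 2.1 (ii)**: `π` satisfies detailed balance with respect to `P` iff `Γ = 0`.
[cite: Bierkens2015, §2.1 Lemma 2.1 (ii)] -/
theorem vorticityOf_eq_zero_iff (π : X → ℝ) (P : Matrix X X ℝ) :
    vorticityOf π P = 0 ↔ DetailedBalance π P := by
  constructor
  · intro h x y
    have := congrFun (congrFun h x) y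
    rw [vorticityOf_apply, Matrix.zero_apply] at this
    linarith
  · intro h
    ext x y
    rw [vorticityOf_apply, Matrix.zero_apply, h x y, sub_self]

omit [DecidableEq X] in
/-- The row sums of the vorticity: `(Γ1)(x) = π(x) − Σ_y π(y)P(y,x)` for a row-stochastic `P`.
[cite: Bierkens2015, §2.1 Lemma 2.1 (proof of (iii))] -/
theorem vorticityOf_rowSum {P : Matrix X X ℝ} (hP : IsRowStochastic P) (π : X → ℝ) (x : X) :
    ∑ y, vorticityOf π P x y = π x - ∑ y, π y * P y x := by
  simp only [vorticityOf_apply, sum_sub_distrib, ← mul_sum, hP.2 x, mul_one]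

omit [DecidableEq X] in
/-- **Lemma 2.1 (iii)**: `π` is invariant for `P` iff `Γ1 = 0`. [cite: Bierkens2015, §2.1
Lemma 2.1 (iii)] -/
theorem isStationary_iff_vorticityOf_rowSum {P : Matrix X X ℝ} (hP : IsRowStochastic P)
    (π : X → ℝ) : IsStationary π P ↔ ∀ x, ∑ y, vorticityOf π P x y = 0 := by
  simp_rw [vorticityOf_rowSum hP]
  constructor
  · intro h x; rw [h x, sub_self]
  · intro h x; linarith [h x]

/-! ## Vorticity matrices and the chain `K + Γ/(2π)` -/

omit [DecidableEq X] in
/-- A VORTICITY MATRIX: skew-symmetric with zero row sums (`Γ = −Γᵀ`, `Γ1 = 0`).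
[cite: Bierkens2015, §2.1 (definition after Lemma 2.1: "a matrix `Γ ∈ ℝ^{n×n}` which is
skew-symmetric and satisfies `Γ1 = 0` is called a vorticity matrix")] -/
def IsVorticity (Γ : Matrix X X ℝ) : Prop := (∀ x y, Γ y x = -Γ x y) ∧ ∀ x, ∑ y, Γ x y = 0

namespace IsVorticity

variable {Γ : Matrix X X ℝ}

omit [DecidableEq X] in
/-- The diagonal of a vorticity matrix vanishes. [cite: Bierkens2015, §2.1 Lemma 2.1 (i)] -/
theorem diag (hΓ : IsVorticity Γ) (x : X) : Γ x x = 0 := by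
  have := hΓ.1 x x; linarith

omit [DecidableEq X] in
/-- Zero column sums: `Σ_x Γ(x,y) = 0` (skew-symmetry and `Γ1 = 0`). [cite: Bierkens2015, §2.1
(definition of a vorticity matrix)] -/
theorem colSum (hΓ : IsVorticity Γ) (y : X) : ∑ x, Γ x y = 0 := by
  have h : ∑ x, Γ x y = -∑ x, Γ y x := by
    rw [← sum_neg_distrib]; exact sum_congr rfl fun x _ => hΓ.1 y x
  rw [h, hΓ.2 y, neg_zero]

omit [DecidableEq X] in
/-- The skew-symmetric double sum vanishes: `Σ_{x,y} Γ(x,y)·s(x,y) = 0` for any SYMMETRIC weight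
`s(x,y) = s(y,x)`. [cite: Bierkens2015, §3.2 ("Since `Γ` is skew-symmetric, the second term
vanishes")] -/
theorem sum_sum_mul_symm_eq_zero (hΓ : IsVorticity Γ) {s : X → X → ℝ} (hs : ∀ x y, s y x = s x y) :
    ∑ x, ∑ y, Γ x y * s x y = 0 := by
  have h : ∑ x, ∑ y, Γ x y * s x y = -∑ x, ∑ y, Γ x y * s x y := by
    conv_lhs => rw [sum_comm]
    rw [← sum_neg_distrib]
    refine sum_congr rfl fun x _ => ?_
    rw [← sum_neg_distrib]
    exact sum_congr rfl fun y _ => by rw [hΓ.1 x y, hs x y]; ring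
  linarith

end IsVorticity

omit [DecidableEq X] in
/-- The vorticity of a stationary pair `(P, π)` (row-stochastic `P`, `πP = π`) is a vorticity
matrix. [cite: Bierkens2015, §2.1 Lemma 2.1 (i), (iii)] -/
theorem isVorticity_vorticityOf {P : Matrix X X ℝ} (hP : IsRowStochastic P) {π : X → ℝ}
    (hst : IsStationary π P) : IsVorticity (vorticityOf π P) :=
  ⟨fun x y => vorticityOf_swap π P x y, (isStationary_iff_vorticityOf_rowSum hP π).1 hst⟩

/-- **The chain with inserted vortices**: `P(x,y) := K(x,y) + Γ(x,y)/(2π(x))` ("a direct way of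
constructing a non-reversible chain `P` from a reversible chain `K` and a vorticity matrix `Γ` …
provided that `P` is a probability matrix"). [cite: Bierkens2015, §2.1 Remark 2.2]
[cite: SunGomezSchmidhuber2010, §3] -/
noncomputable def addVorticity (K : Matrix X X ℝ) (π : X → ℝ) (Γ : Matrix X X ℝ) : Matrix X X ℝ :=
  Matrix.of fun x y => K x y + Γ x y / (2 * π x)

section AddVorticity

variable {K Γ : Matrix X X ℝ} {π : X → ℝ}

omit [Fintype X] [DecidableEq X] in
/-- Entry formula. [cite: Bierkens2015, §2.1 Remark 2.2] -/
theorem addVorticity_apply (K : Matrix X X ℝ) (π : X → ℝ) (Γ : Matrix X X ℝ) (x y : X) :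
    addVorticity K π Γ x y = K x y + Γ x y / (2 * π x) := rfl

omit [DecidableEq X] in
/-- Rows of `K + Γ/(2π)` sum to `1` (because `Γ1 = 0`). [cite: Bierkens2015, §2.1 Remark 2.2] -/
theorem addVorticity_rowSum (hK : IsRowStochastic K) (hΓ : IsVorticity Γ) (x : X) :
    ∑ y, addVorticity K π Γ x y = 1 := by
  simp only [addVorticity_apply, sum_add_distrib, hK.2 x]
  rw [← sum_div, hΓ.2 x, zero_div, add_zero]

omit [DecidableEq X] in
/-- `K + Γ/(2π)` is a transition matrix as soon as its entries are non-negative (the printed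
proviso). [cite: Bierkens2015, §2.1 Remark 2.2] -/
theorem addVorticity_isRowStochastic (hK : IsRowStochastic K) (hΓ : IsVorticity Γ)
    (hnn : ∀ x y, 0 ≤ addVorticity K π Γ x y) : IsRowStochastic (addVorticity K π Γ) :=
  ⟨hnn, addVorticity_rowSum hK hΓ⟩

omit [Fintype X] [DecidableEq X] in
/-- The flow of `K + Γ/(2π)`: `π(x)P(x,y) = π(x)K(x,y) + Γ(x,y)/2` (`π(x) ≠ 0`).
[cite: Bierkens2015, §2.1 Remark 2.2] -/
theorem mul_addVorticity (hπ : ∀ x, 0 < π x) (x y : X) :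
    π x * addVorticity K π Γ x y = π x * K x y + Γ x y / 2 := by
  rw [addVorticity_apply, mul_add, mul_comm (π x) (Γ x y / (2 * π x)), div_mul_eq_mul_div,
    mul_div_mul_right _ _ (hπ x).ne']

omit [DecidableEq X] in
/-- **`π` is invariant for `K + Γ/(2π)`** (`K` row-stochastic with `πK = π`, `π > 0`, `Γ` a
vorticity matrix): `Σ_x π(x)P(x,y) = π(y) + ½Σ_x Γ(x,y) = π(y)`. [cite: Bierkens2015, §2.1
Lemma 2.1 (iii) with Remark 2.2] [cite: SunGomezSchmidhuber2010, §3] -/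
theorem addVorticity_isStationary (hπ : ∀ x, 0 < π x) (hstK : IsStationary π K)
    (hΓ : IsVorticity Γ) : IsStationary π (addVorticity K π Γ) := by
  intro y
  simp_rw [mul_addVorticity hπ, sum_add_distrib, hstK y, ← sum_div, hΓ.colSum y, zero_div,
    add_zero]

omit [DecidableEq X] in
/-- **The vorticity of `(K + Γ/(2π), π)` is `Γ`** when `K` is reversible for the positive `π`.
[cite: Bierkens2015, §2.1 Remark 2.2 with Lemma 2.4 (`Γ` is the vorticity matrix of the constructed
chain)] -/
theorem vorticityOf_addVorticity (hπ : ∀ x, 0 < π x) (hDB : DetailedBalance π K)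
    (hΓ : IsVorticity Γ) : vorticityOf π (addVorticity K π Γ) = Γ := by
  ext x y
  rw [vorticityOf_apply, mul_addVorticity hπ, mul_addVorticity hπ, hDB x y, hΓ.1 x y]
  ring

omit [DecidableEq X] in
/-- `K + Γ/(2π)` is reversible for `π` iff `Γ = 0`: inserting a non-zero vorticity makes the chain
non-reversible. [cite: Bierkens2015, §2.1 Lemma 2.1 (ii) with Remark 2.2] -/
theorem addVorticity_detailedBalance_iff (hπ : ∀ x, 0 < π x)
    (hDB : DetailedBalance π K) (hΓ : IsVorticity Γ) :
    DetailedBalance π (addVorticity K π Γ) ↔ Γ = 0 := by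
  rw [← vorticityOf_eq_zero_iff, vorticityOf_addVorticity hπ hDB hΓ]

omit [DecidableEq X] in
/-- **The Dirichlet form does not see the vortices: `𝓔_{K + Γ/(2π)}(u) = 𝓔_K(u)`** for every `u`
(`Σ_{x,y} Γ(x,y)(u(x) − u(y))² = 0` by skew-symmetry). [cite: Bierkens2015, §3.2 ("Since `Γ` is
skew-symmetric, the second term vanishes")] [cite: SunGomezSchmidhuber2010, §3] -/
theorem dirichletForm_addVorticity (hπ : ∀ x, 0 < π x) (hΓ : IsVorticity Γ) (u : X → ℝ) :
    dirichletForm π (addVorticity K π Γ) u = dirichletForm π K u := by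
  unfold dirichletForm
  congr 1
  have h : ∀ x y, π x * addVorticity K π Γ x y * (u x - u y) ^ 2
      = π x * K x y * (u x - u y) ^ 2 + (1 / 2) * (Γ x y * (u x - u y) ^ 2) := by
    intro x y
    rw [mul_addVorticity hπ]
    ring
  simp_rw [h, sum_add_distrib, ← mul_sum]
  rw [hΓ.sum_sum_mul_symm_eq_zero (fun x y => by ring), mul_zero, add_zero]

end AddVorticity

/-! ## Proposition 3.1: vortices never increase the asymptotic variance -/

section Prop31

variable {K Γ : Matrix X X ℝ} {π : X → ℝ}

omit [DecidableEq X] in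
/-- `(A v)(x) = Σ_y π(y)v(y)`. [folklore] -/
private theorem limitMatrix_mulVec' (π v : X → ℝ) (x : X) :
    (limitMatrix π *ᵥ v) x = ∑ y, π y * v y := by
  rw [Matrix.mulVec_apply_eq_sum]
  rfl

/-- Entries of `(I − (P − A))v`. [folklore] -/
private theorem fundamentalInv_mulVec' (π : X → ℝ) (P : Matrix X X ℝ) (v : X → ℝ) (x : X) :
    ((1 - (P - limitMatrix π)) *ᵥ v) x = v x - ∑ y, P x y * v y + ∑ y, π y * v y := by
  rw [sub_mulVec, sub_mulVec, one_mulVec, Pi.sub_apply, Pi.sub_apply, Matrix.mulVec_apply_eq_sum,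
    limitMatrix_mulVec']
  ring

/-- `Z` preserves the `π`-mean: `Σ_y π(y)(Zg)(y) = Σ_y π(y)g(y)` (`π(I − P + A) = π`). [folklore] -/
private theorem sum_mul_fundamentalMatrix_mulVec' {P : Matrix X X ℝ} (hπ1 : ∑ x, π x = 1)
    (hst : IsStationary π P) (hU : IsUnit (1 - (P - limitMatrix π))) (g : X → ℝ) :
    ∑ y, π y * (fundamentalMatrix π P *ᵥ g) y = ∑ y, π y * g y := by
  have h1 : π ᵥ* (1 - (P - limitMatrix π)) = π := by
    funext y
    change ∑ x, π x * (1 - (P - limitMatrix π)) x y = π y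
    have h2 : ∀ x, π x * (1 - (P - limitMatrix π)) x y
        = π x * (1 : Matrix X X ℝ) x y - π x * P x y + π x * π y := by
      intro x
      simp only [Matrix.sub_apply, limitMatrix, Matrix.of_apply]
      ring
    simp_rw [h2, sum_add_distrib, sum_sub_distrib, ← sum_mul, hπ1, one_mul, hst y,
      Matrix.one_apply, mul_ite, mul_one, mul_zero, sum_ite_eq' univ y, if_pos (mem_univ y)]
    ring
  have h3 : π ᵥ* fundamentalMatrix π P = π := by
    calc π ᵥ* fundamentalMatrix π P
        = π ᵥ* (1 - (P - limitMatrix π)) ᵥ* fundamentalMatrix π P := by rw [h1]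
      _ = π ᵥ* ((1 - (P - limitMatrix π)) * fundamentalMatrix π P) := vecMul_vecMul _ _ _
      _ = π := by rw [fundamentalInv_mul_fundamentalMatrix hU, vecMul_one]
  change π ⬝ᵥ (fundamentalMatrix π P *ᵥ g) = π ⬝ᵥ g
  rw [dotProduct_mulVec, h3]

/-- The deficit identity behind Proposition 3.1: for `P = K + Γ/(2π)` (both with fundamental
matrices) and every `f`, **`v(f,π,K) − v(f,π,P) = 2𝓔_K(Z_K f̄ − Z_P f̄)`** (`≥ 0`) — Bellman's
identity `2⟨g,u⟩ − 𝓔_K(u) = ⟨g,Z_K g⟩ − 𝓔_K(Z_K g − u)` of `PeskunOrdering.variational_identity` at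
`u = Z_P g`, combined with `𝓔_P = 𝓔_K` and `𝓔_P(Z_P g) = ⟨g, Z_P g⟩`.
[cite: Bierkens2015, §3.1 Prop. 3.1 (proof route declared in the module docstring)] -/
theorem asympVar_sub_asympVar_addVorticity (hπ : ∀ x, 0 < π x) (hπ1 : ∑ x, π x = 1)
    (hK : IsRowStochastic K) (hDB : DetailedBalance π K)
    (hUK : IsUnit (1 - (K - limitMatrix π))) (hΓ : IsVorticity Γ)
    (hP : IsRowStochastic (addVorticity K π Γ))
    (hUP : IsUnit (1 - (addVorticity K π Γ - limitMatrix π))) (f : X → ℝ) :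
    asympVar f π K - asympVar f π (addVorticity K π Γ)
      = 2 * dirichletForm π K
          (fundamentalMatrix π K *ᵥ centred π f
            - fundamentalMatrix π (addVorticity K π Γ) *ᵥ centred π f) := by
  have hstK : IsStationary π K := hDB.isStationary hK.2
  have hstP : IsStationary π (addVorticity K π Γ) := addVorticity_isStationary hπ hstK hΓ
  have hg0 : ∑ y, π y * centred π f y = 0 := sum_mul_centred hπ1 f
  rw [asympVar_eq_centred hπ1 hK hstK hUK f, asympVar_eq_centred hπ1 hP hstP hUP f]
  have h1 := variational_eq hπ1 hP hstP hUP hg0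
  have h2 := variational_identity hπ1 hK hDB hUK hg0
    (fundamentalMatrix π (addVorticity K π Γ) *ᵥ centred π f)
  rw [dirichletForm_addVorticity hπ hΓ] at h1
  linarith

/-- **Proposition 3.1 (Sun–Gomez–Schmidhuber 2010; Chen–Hwang 2013), as stated in [Bierkens2015].**
Let `K` be the transition matrix of an irreducible reversible Markov chain with positive invariant
probability vector `π`, let `Γ` be a vorticity matrix and let `P = K + ½diag(π)⁻¹Γ` be the
transition matrix (entries `≥ 0`) of an irreducible Markov chain.  Then for every `f : X → ℝ` the
asymptotic variances satisfy **`σ²_{f,P} ≤ σ²_{f,K}`** — "adding non-reversibility decreases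
asymptotic variance". [cite: Bierkens2015, §3.1 Prop. 3.1] [cite: SunGomezSchmidhuber2010, §3]
[cite: ChenHwang2013, Thm 1] -/
theorem Bierkens2015_prop_3_1 (hπ : ∀ x, 0 < π x) (hπ1 : ∑ x, π x = 1)
    (hK : IsRowStochastic K) (hDB : DetailedBalance π K) (hirrK : IsIrreducible K)
    (hΓ : IsVorticity Γ) (hnn : ∀ x y, 0 ≤ addVorticity K π Γ x y)
    (hirrP : IsIrreducible (addVorticity K π Γ)) (f : X → ℝ) :
    asympVar f π (addVorticity K π Γ) ≤ asympVar f π K := by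
  have hstK : IsStationary π K := hDB.isStationary hK.2
  have hP : IsRowStochastic (addVorticity K π Γ) := addVorticity_isRowStochastic hK hΓ hnn
  have hstP : IsStationary π (addVorticity K π Γ) := addVorticity_isStationary hπ hstK hΓ
  have hUK := isUnit_fundamentalInv hπ1 hK hstK hirrK
  have hUP := isUnit_fundamentalInv hπ1 hP hstP hirrP
  have h := asympVar_sub_asympVar_addVorticity hπ hπ1 hK hDB hUK hΓ hP hUP f
  have h0 := dirichletForm_nonneg (fun x => (hπ x).le) hK.1
    (fundamentalMatrix π K *ᵥ centred π f - fundamentalMatrix π (addVorticity K π Γ) *ᵥ centred π f)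
  linarith

/-- For an irreducible reversible `K` with positive stationary `π` (`|X| ≥ 2`), the Dirichlet form
is coercive on centred functions: `𝓔_K(d) ≥ γ·‖d‖²_π` with `γ > 0`, so a centred `d ≠ 0` has
`𝓔_K(d) > 0`. [folklore] -/
private theorem dirichletForm_pos_of_centred [Nontrivial X] (hπ : ∀ x, 0 < π x)
    (hπ1 : ∑ x, π x = 1) (hK : IsRowStochastic K) (hDB : DetailedBalance π K)
    (hirrK : IsIrreducible K) {d : X → ℝ} (hd0 : ∑ x, π x * d x = 0) (hd : d ≠ 0) :
    0 < dirichletForm π K d := by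
  have hπ0 : ∀ x, 0 ≤ π x := fun x => (hπ x).le
  -- `‖d‖²_π > 0`
  have hI : 0 < piInner π d d := by
    obtain ⟨x₀, hx₀⟩ : ∃ x, d x ≠ 0 := by
      by_contra hcon
      apply hd
      funext x
      by_contra hx
      exact hcon ⟨x, hx⟩
    have hle : π x₀ * (d x₀ * d x₀) ≤ piInner π d d :=
      single_le_sum (f := fun x => π x * (d x * d x))
        (fun x _ => mul_nonneg (hπ0 x) (mul_self_nonneg _)) (mem_univ x₀)
    have hpos : 0 < π x₀ * (d x₀ * d x₀) := mul_pos (hπ x₀) (mul_self_pos.mpr hx₀)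
    exact hpos.trans_le hle
  -- normalise and use `Gap_R ≤ 𝓔(d/‖d‖)` with `Gap_R = γ > 0`
  obtain ⟨c, hc⟩ : ∃ c : ℝ, c = Real.sqrt (piInner π d d) := ⟨_, rfl⟩
  have hcpos : 0 < c := by rw [hc]; exact Real.sqrt_pos.mpr hI
  have hc2 : c ^ 2 = piInner π d d := by rw [hc]; exact Real.sq_sqrt hI.le
  have he0 : ∑ x, π x * ((1 / c) * d x) = 0 := by
    have : ∑ x, π x * ((1 / c) * d x) = (1 / c) * ∑ x, π x * d x := by
      rw [mul_sum]; exact sum_congr rfl fun x _ => by ring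
    rw [this, hd0, mul_zero]
  have he1 : piInner π (fun x => (1 / c) * d x) (fun x => (1 / c) * d x) = 1 := by
    have : piInner π (fun x => (1 / c) * d x) (fun x => (1 / c) * d x)
        = (1 / c) ^ 2 * piInner π d d := by
      unfold piInner; rw [mul_sum]; exact sum_congr rfl fun x _ => by ring
    rw [this, ← hc2, div_pow, one_pow, one_div, inv_mul_cancel₀ (pow_ne_zero 2 hcpos.ne')]
  have hgap : spectralGapR π K ≤ dirichletForm π K (fun x => (1 / c) * d x) :=
    spectralGapR_le_dirichletForm hπ0 hK.1 he0 he1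
  have hEe : dirichletForm π K (fun x => (1 / c) * d x) = (1 / c) ^ 2 * dirichletForm π K d :=
    dirichletForm_smul π K (1 / c) d
  have hγ : 0 < spectralGapR π K := by
    rw [← LevinPeres2017_lemma_13_7 hπ hπ1 hK hDB]
    exact spectralGap_pos hπ hπ1 hK hDB hirrK
  have h1 : 0 < (1 / c) ^ 2 * dirichletForm π K d := by linarith
  have h2 : 0 < (1 / c) ^ 2 := by positivity
  exact pos_of_mul_pos_right h1 h2.le

/-- **Proposition 3.1, strict part.**  Under the hypotheses of `Bierkens2015_prop_3_1`, if the
vorticity matrix is NON-ZERO (`Γ ≠ 0`, on a space with at least two points) then **there exists an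
`f` with `σ²_{f,P} < σ²_{f,K}`**.  Witness: `f = h − Kh` for a centred `h` with `Γh ≠ 0`; then
`Z_K f = h`, and `Z_K f − Z_P f` is centred and non-zero (were it zero, applying `I − P + A` would
give `Γh = 0`), so the deficit `2𝓔_K(Z_K f − Z_P f)` is positive.
[cite: Bierkens2015, §3.1 Prop. 3.1 ("there exists an `f` such that `σ²_{f,P} < σ²_{f,K}`")]
[cite: SunGomezSchmidhuber2010, §3] -/
theorem Bierkens2015_prop_3_1_strict [Nontrivial X] (hπ : ∀ x, 0 < π x) (hπ1 : ∑ x, π x = 1)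
    (hK : IsRowStochastic K) (hDB : DetailedBalance π K) (hirrK : IsIrreducible K)
    (hΓ : IsVorticity Γ) (hΓ0 : Γ ≠ 0) (hnn : ∀ x y, 0 ≤ addVorticity K π Γ x y)
    (hirrP : IsIrreducible (addVorticity K π Γ)) :
    ∃ f : X → ℝ, asympVar f π (addVorticity K π Γ) < asympVar f π K := by
  have hstK : IsStationary π K := hDB.isStationary hK.2
  have hP : IsRowStochastic (addVorticity K π Γ) := addVorticity_isRowStochastic hK hΓ hnn
  have hstP : IsStationary π (addVorticity K π Γ) := addVorticity_isStationary hπ hstK hΓ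
  have hUK := isUnit_fundamentalInv hπ1 hK hstK hirrK
  have hUP := isUnit_fundamentalInv hπ1 hP hstP hirrP
  -- an entry `Γ i j ≠ 0`
  obtain ⟨i, j, hij⟩ : ∃ i j, Γ i j ≠ 0 := by
    by_contra hcon
    apply hΓ0
    ext i j
    rw [Matrix.zero_apply]
    by_contra hne
    exact hcon ⟨i, j, hne⟩
  -- the centred vector `h = e_j − π(j)` has `(Γh)(i) = Γ i j ≠ 0` (because `Γ1 = 0`)
  obtain ⟨h, hheq⟩ : ∃ h : X → ℝ, h = centred π ((Pi.single j (1 : ℝ) : X → ℝ)) := ⟨_, rfl⟩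
  have hh0 : ∑ y, π y * h y = 0 := by rw [hheq]; exact sum_mul_centred hπ1 _
  have hΓhi : (Γ *ᵥ h) i ≠ 0 := by
    have e1 : (Γ *ᵥ h) i = ∑ y, Γ i y * (Pi.single j (1 : ℝ) : X → ℝ) y
        - (∑ z, π z * (Pi.single j (1 : ℝ) : X → ℝ) z) * ∑ y, Γ i y := by
      rw [hheq, Matrix.mulVec_apply_eq_sum]
      simp only [centred, mul_sub, sum_sub_distrib]
      congr 1
      rw [mul_sum]
      exact sum_congr rfl fun y _ => by ring
    rw [e1, hΓ.2 i, mul_zero, sub_zero]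
    simp only [Pi.single_apply, mul_ite, mul_one, mul_zero, Finset.sum_ite_eq',
      Finset.mem_univ, if_true]
    exact hij
  -- the witness `f = h − Kh`; it is centred and `Z_K f = h`
  obtain ⟨f, hfeq⟩ : ∃ f : X → ℝ, f = fun x => h x - ∑ y, K x y * h y := ⟨_, rfl⟩
  have hKh : ∑ x, π x * ∑ y, K x y * h y = ∑ y, π y * h y := by
    calc ∑ x, π x * ∑ y, K x y * h y = ∑ x, ∑ y, π x * K x y * h y := by
          refine sum_congr rfl fun x _ => ?_
          rw [mul_sum]
          exact sum_congr rfl fun y _ => by ring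
      _ = ∑ y, ∑ x, π x * K x y * h y := sum_comm
      _ = ∑ y, (∑ x, π x * K x y) * h y := by
          refine sum_congr rfl fun y _ => ?_
          rw [sum_mul]
      _ = ∑ y, π y * h y := by
          refine sum_congr rfl fun y _ => ?_
          rw [hstK y]
  have hf0 : ∑ x, π x * f x = 0 := by
    have h1 : ∑ x, π x * f x = ∑ x, π x * h x - ∑ x, π x * ∑ y, K x y * h y := by
      simp only [hfeq, mul_sub, sum_sub_distrib]
    rw [h1, hKh, hh0, sub_self]
  have hfc : centred π f = f := by
    funext x
    unfold centred
    rw [hf0, sub_zero]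
  have hinvK : (1 - (K - limitMatrix π)) *ᵥ h = f := by
    funext x
    rw [fundamentalInv_mulVec', hh0, add_zero, hfeq]
  have hZKf : fundamentalMatrix π K *ᵥ f = h := by
    rw [← hinvK, mulVec_mulVec, fundamentalMatrix_mul_fundamentalInv hUK, one_mulVec]
  -- the difference `d = Z_K f − Z_P f` is centred …
  obtain ⟨d, hdeq⟩ : ∃ d : X → ℝ,
      d = fundamentalMatrix π K *ᵥ f - fundamentalMatrix π (addVorticity K π Γ) *ᵥ f := ⟨_, rfl⟩
  have hd0 : ∑ x, π x * d x = 0 := by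
    rw [hdeq]
    simp only [Pi.sub_apply, mul_sub, sum_sub_distrib]
    rw [sum_mul_fundamentalMatrix_mulVec' hπ1 hstK hUK,
      sum_mul_fundamentalMatrix_mulVec' hπ1 hstP hUP, sub_self]
  -- … and non-zero: otherwise `Z_P f = h`, and applying `I − P + A` gives `Γ h = 0`
  have hdne : d ≠ 0 := by
    intro hd
    have hZPf : fundamentalMatrix π (addVorticity K π Γ) *ᵥ f = h := by
      have : fundamentalMatrix π K *ᵥ f - fundamentalMatrix π (addVorticity K π Γ) *ᵥ f = 0 := by
        rw [← hdeq, hd]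
      rw [hZKf, sub_eq_zero] at this
      exact this.symm
    have happly : (1 - (addVorticity K π Γ - limitMatrix π)) *ᵥ h = f := by
      rw [← hZPf, mulVec_mulVec, fundamentalInv_mul_fundamentalMatrix hUP, one_mulVec]
    have hx := congrFun happly i
    rw [fundamentalInv_mulVec', hh0, add_zero] at hx
    have hPi : ∑ y, addVorticity K π Γ i y * h y = ∑ y, K i y * h y + (Γ *ᵥ h) i / (2 * π i) := by
      rw [Matrix.mulVec_apply_eq_sum, sum_div, ← sum_add_distrib]
      refine sum_congr rfl fun y _ => ?_
      rw [addVorticity_apply]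
      ring
    have hfi : f i = h i - ∑ y, K i y * h y := by rw [hfeq]
    rw [hPi, hfi] at hx
    have hq : (Γ *ᵥ h) i / (2 * π i) = 0 := by linarith
    rw [div_eq_zero_iff] at hq
    rcases hq with hq | hq
    · exact hΓhi hq
    · linarith [hπ i]
  -- conclude with the deficit identity
  refine ⟨f, ?_⟩
  have hdeficit := asympVar_sub_asympVar_addVorticity hπ hπ1 hK hDB hUK hΓ hP hUP f
  rw [hfc, ← hdeq] at hdeficit
  have hpos : 0 < dirichletForm π K d := dirichletForm_pos_of_centred hπ hπ1 hK hDB hirrK hd0 hdne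
  linarith

end Prop31

end Literature.Probability.MarkovChains

namespace Literature.Probability.MarkovChains

open Finset Matrix

variable {X : Type*} [Fintype X] [DecidableEq X]

/-! ## Non-reversible Metropolis–Hastings (Bierkens 2015 §2.3, Theorem 2.5)

(Appended.)  Source: [Bierkens2015] §2.3 "Non-reversible Metropolis-Hastings": given a proposal
chain `Q`, a vorticity matrix `Γ` and an everywhere-positive weight `π`, the NON-REVERSIBLE HASTINGS
RATIO `R_Γ(x,y) := (Γ(x,y) + π(y)Q(y,x)) / (π(x)Q(x,y))` if `π(x)Q(x,y) ≠ 0`, `:= 1` otherwise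
(eq:hastings-ratio), the acceptance probabilities `A_Γ(x,y) := min(1, R_Γ(x,y))`
(eq:acceptance-Gamma), the VORTICITY BOUND `Γ(x,y) ≥ −π(y)Q(y,x)` for all `x, y`
(eq:vorticity_bound) ("in order to avoid the situation that `A_Γ` becomes negative"), and the
transition probabilities (eq:transition-Gamma) `P_Γ(x,y) := Q(x,y)A_Γ(x,y)` (`x ≠ y`),
`P_Γ(x,x) := Q(x,x) + Σ_{z≠x} Q(x,z)(1 − A_Γ(x,z))`; **LEMMA 2.4**: "`Γ(x,y) = π(x)P_Γ(x,y) −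
π(y)P_Γ(y,x)` for all `x, y ∈ S`"; **THEOREM 2.5**: "Let `Q` be a Markov chain, `Γ` a vorticity
matrix, and `π` a distribution on `S` that is everywhere positive, such that (eq:symmetric_structure)
and (eq:vorticity_bound) are satisfied … Then `P_Γ` has `π` as invariant distribution and `Γ` as its
vorticity matrix"; "For `Γ = 0`, `A_Γ` and therefore `P_Γ` reduce to `A_0` and `P_0`";
**PROPOSITION 2.8** (with `Q = P` and `Γ` the vorticity of `(P, π)`, "the resulting Markov chain `P_Γ`
is identical to `P`"); **PROPOSITION 2.10** (NRMH with proposal `Q = H + Γ/(2π)` equals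
`K + Γ/(2π)` with `K` the classical Metropolis–Hastings kernel of `H`: "`π(x)P₁(x,y) =
min(π(x)Q(x,y), Γ(x,y) + π(y)Q(y,x))`").
In the tree's Metropolis–Hastings vocabulary (`mhRate T π x y = min (T x y) (π y T y x / π x)`,
`mhKernel`, `MetropolisHastings.lean`) the off-diagonal NRMH rate is written in the same FLUX FORM
`nrmhRate Q π Γ x y = min (Q x y) ((Γ x y + π y Q y x)/π x)`; `nrmhRate_eq_printed` proves it equals
the printed `Q(x,y)·min(1, R_Γ(x,y))` (with the "`1` otherwise" convention) under the vorticity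
bound, so nothing is lost.  Everything below is PROVED; the symmetric-structure condition
(eq:symmetric_structure) and irreducibility are not needed for these algebraic identities and are not
assumed.
-/

section NRMH

variable {Q : Matrix X X ℝ} {π : X → ℝ} {Γ : Matrix X X ℝ}

omit [Fintype X] [DecidableEq X] in
/-- The NRMH off-diagonal rate in flux form: `min (Q x y) ((Γ x y + π y Q y x)/π x)`
(`= Q(x,y) A_Γ(x,y)`, `nrmhRate_eq_printed`). [cite: Bierkens2015, §2.3 eqs. (hastings-ratio),
(acceptance-Gamma), (transition-Gamma); Prop. 2.10 (proof: "`π(x)P₁(x,y) = min(π(x)Q(x,y), Γ(x,y) +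
π(y)Q(y,x))`")] -/
noncomputable def nrmhRate (Q : Matrix X X ℝ) (π : X → ℝ) (Γ : Matrix X X ℝ) (x y : X) : ℝ :=
  min (Q x y) ((Γ x y + π y * Q y x) / π x)

/-- The NRMH kernel `P_Γ`: off the diagonal `nrmhRate`, on the diagonal the remaining mass
`Q(x,x) + Σ_{z≠x} Q(x,z)(1 − A_Γ(x,z)) = 1 − Σ_{z≠x} Q(x,z)A_Γ(x,z)` (`nrmhKernel_self_eq_printed`).
[cite: Bierkens2015, §2.3 eq. (transition-Gamma)] -/
noncomputable def nrmhKernel (Q : Matrix X X ℝ) (π : X → ℝ) (Γ : Matrix X X ℝ) : Matrix X X ℝ :=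
  Matrix.of fun x y => if y = x then 1 - ∑ z ∈ univ.erase x, nrmhRate Q π Γ x z else nrmhRate Q π Γ x y

/-- Off-diagonal entries. [cite: Bierkens2015, §2.3 eq. (transition-Gamma)] -/
theorem nrmhKernel_of_ne {x y : X} (h : y ≠ x) : nrmhKernel Q π Γ x y = nrmhRate Q π Γ x y :=
  if_neg h

/-- Diagonal entry. [cite: Bierkens2015, §2.3 eq. (transition-Gamma)] -/
theorem nrmhKernel_self (x : X) :
    nrmhKernel Q π Γ x x = 1 - ∑ z ∈ univ.erase x, nrmhRate Q π Γ x z := if_pos rfl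

omit [Fintype X] [DecidableEq X] in
/-- Flux identity: `π(x)·nrmhRate(x,y) = min(π(x)Q(x,y), Γ(x,y) + π(y)Q(y,x))`.
[cite: Bierkens2015, §2.3 Lemma 2.4 (proof) and Prop. 2.10 (proof)] -/
theorem mul_nrmhRate (hπ : ∀ x, 0 < π x) (x y : X) :
    π x * nrmhRate Q π Γ x y = min (π x * Q x y) (Γ x y + π y * Q y x) := by
  unfold nrmhRate
  rw [(monotone_mul_left_of_nonneg (hπ x).le).map_min]
  congr 1
  rw [mul_div_assoc', mul_div_cancel_left₀ _ (hπ x).ne']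

omit [Fintype X] [DecidableEq X] in
/-- `nrmhRate ≤ Q` entrywise. [cite: Bierkens2015, §2.3 (`A_Γ ≤ 1`)] -/
theorem nrmhRate_le (x y : X) : nrmhRate Q π Γ x y ≤ Q x y := min_le_left _ _

omit [Fintype X] [DecidableEq X] in
/-- Under the VORTICITY BOUND `Γ(x,y) ≥ −π(y)Q(y,x)` (and `Q ≥ 0`, `π > 0`) the rate is
non-negative ("in order to avoid the situation that `A_Γ` becomes negative").
[cite: Bierkens2015, §2.3 eq. (vorticity_bound)] -/
theorem nrmhRate_nonneg (hπ : ∀ x, 0 < π x) (hQ : ∀ x y, 0 ≤ Q x y)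
    (hbound : ∀ x y, -(π y * Q y x) ≤ Γ x y) (x y : X) : 0 ≤ nrmhRate Q π Γ x y :=
  le_min (hQ x y) (div_nonneg (by linarith [hbound x y]) (hπ x).le)

omit [Fintype X] [DecidableEq X] in
/-- **Faithfulness to the printed form**: under the vorticity bound,
`nrmhRate(x,y) = Q(x,y) · min(1, R_Γ(x,y))` with `R_Γ(x,y) = (Γ(x,y) + π(y)Q(y,x))/(π(x)Q(x,y))`
if `π(x)Q(x,y) ≠ 0` and `R_Γ := 1` otherwise. [cite: Bierkens2015, §2.3 eqs. (hastings-ratio),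
(acceptance-Gamma), (transition-Gamma)] -/
theorem nrmhRate_eq_printed (hπ : ∀ x, 0 < π x) (hQ : ∀ x y, 0 ≤ Q x y)
    (hbound : ∀ x y, -(π y * Q y x) ≤ Γ x y) (x y : X) :
    nrmhRate Q π Γ x y = Q x y *
      min 1 (if π x * Q x y ≠ 0 then (Γ x y + π y * Q y x) / (π x * Q x y) else 1) := by
  unfold nrmhRate
  have hx := hπ x
  rcases (hQ x y).eq_or_lt with h0 | hpos
  · -- `Q x y = 0`: both sides vanish (the second argument of the `min` is `≥ 0`)
    rw [← h0, zero_mul, min_eq_left (div_nonneg (by linarith [hbound x y]) hx.le)]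
  · have hne : π x * Q x y ≠ 0 := mul_ne_zero hx.ne' hpos.ne'
    rw [if_pos hne, (monotone_mul_left_of_nonneg hpos.le).map_min, mul_one]
    congr 1
    field_simp

omit [Fintype X] [DecidableEq X] in
/-- **Γ = 0 is classical Metropolis–Hastings**: `nrmhRate Q π 0 = mhRate Q π` ("for `Γ = 0`, `A_Γ`
and therefore `P_Γ` reduce to `A_0` and `P_0`"). [cite: Bierkens2015, §2.3 (consistency remark)] -/
theorem nrmhRate_zero (Q : Matrix X X ℝ) (π : X → ℝ) : nrmhRate Q π 0 = mhRate Q π := by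
  ext x y
  rw [nrmhRate, mhRate, Matrix.zero_apply, zero_add]

/-- `P_0 = ` the Metropolis–Hastings kernel of the tree. [cite: Bierkens2015, §2.3 (consistency
remark)] -/
theorem nrmhKernel_zero (Q : Matrix X X ℝ) (π : X → ℝ) (x y : X) :
    nrmhKernel Q π 0 x y = mhKernel Q π x y := by
  by_cases h : y = x
  · subst h; rw [nrmhKernel_self, mhKernel_self, nrmhRate_zero]
  · rw [nrmhKernel_of_ne h, mhKernel_of_ne h, nrmhRate_zero]

/-- Rows of `P_Γ` sum to one (by construction of the diagonal). [cite: Bierkens2015, §2.3 ("Note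
that indeed `P_Γ` is a matrix of transition probabilities")] -/
theorem nrmhKernel_rowSum (Q : Matrix X X ℝ) (π : X → ℝ) (Γ : Matrix X X ℝ) (x : X) :
    ∑ y, nrmhKernel Q π Γ x y = 1 := by
  rw [← add_sum_erase _ _ (mem_univ x), nrmhKernel_self]
  have : ∑ y ∈ univ.erase x, nrmhKernel Q π Γ x y = ∑ y ∈ univ.erase x, nrmhRate Q π Γ x y :=
    sum_congr rfl fun y hy => nrmhKernel_of_ne (ne_of_mem_erase hy)
  rw [this]
  ring

/-- The printed diagonal: `P_Γ(x,x) = Q(x,x) + Σ_{z≠x} Q(x,z)(1 − A_Γ(x,z))` for a stochastic `Q`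
(under the vorticity bound, so that `Q A_Γ = nrmhRate`). [cite: Bierkens2015, §2.3
eq. (transition-Gamma)] -/
theorem nrmhKernel_self_eq_printed (hπ : ∀ x, 0 < π x) (hQ : IsRowStochastic Q)
    (hbound : ∀ x y, -(π y * Q y x) ≤ Γ x y) (x : X) :
    nrmhKernel Q π Γ x x = Q x x + ∑ z ∈ univ.erase x, (Q x z - Q x z *
      min 1 (if π x * Q x z ≠ 0 then (Γ x z + π z * Q z x) / (π x * Q x z) else 1)) := by
  rw [nrmhKernel_self, sum_sub_distrib]
  have hrow : Q x x + ∑ z ∈ univ.erase x, Q x z = 1 := by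
    rw [add_sum_erase _ _ (mem_univ x)]; exact hQ.2 x
  have hr : ∑ z ∈ univ.erase x, nrmhRate Q π Γ x z = ∑ z ∈ univ.erase x, Q x z *
      min 1 (if π x * Q x z ≠ 0 then (Γ x z + π z * Q z x) / (π x * Q x z) else 1) :=
    sum_congr rfl fun z _ => nrmhRate_eq_printed hπ hQ.1 hbound x z
  rw [hr]
  linarith

/-- `P_Γ ≥ 0` under the vorticity bound, for a stochastic proposal `Q`. [cite: Bierkens2015, §2.3
eq. (vorticity_bound) ("Note that indeed `P_Γ` is a matrix of transition probabilities")] -/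
theorem nrmhKernel_nonneg (hπ : ∀ x, 0 < π x) (hQ : IsRowStochastic Q)
    (hbound : ∀ x y, -(π y * Q y x) ≤ Γ x y) (x y : X) : 0 ≤ nrmhKernel Q π Γ x y := by
  by_cases h : y = x
  · subst h
    rw [nrmhKernel_self, sub_nonneg]
    calc ∑ z ∈ univ.erase y, nrmhRate Q π Γ y z ≤ ∑ z ∈ univ.erase y, Q y z :=
          sum_le_sum fun z _ => nrmhRate_le y z
      _ ≤ ∑ z, Q y z :=
          sum_le_sum_of_subset_of_nonneg (erase_subset _ _) fun z _ _ => hQ.1 y z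
      _ = 1 := hQ.2 y
  · rw [nrmhKernel_of_ne h]; exact nrmhRate_nonneg hπ hQ.1 hbound x y

/-- `P_Γ` is a stochastic matrix (compatible combination). [cite: Bierkens2015, §2.3, Remark 2.6] -/
theorem nrmhKernel_isRowStochastic (hπ : ∀ x, 0 < π x) (hQ : IsRowStochastic Q)
    (hbound : ∀ x y, -(π y * Q y x) ≤ Γ x y) : IsRowStochastic (nrmhKernel Q π Γ) :=
  ⟨nrmhKernel_nonneg hπ hQ hbound, nrmhKernel_rowSum Q π Γ⟩

/-- **LEMMA 2.4**: `Γ` is the vorticity of `(P_Γ, π)`: `π(x)P_Γ(x,y) − π(y)P_Γ(y,x) = Γ(x,y)` for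
all `x, y` (`Γ` skew-symmetric with zero diagonal; in flux form the identity is
`min(a, g + b) − min(b, a − g) = g` and needs no sign condition). [cite: Bierkens2015, §2.3 Lemma 2.4] -/
theorem vorticityOf_nrmhKernel (hπ : ∀ x, 0 < π x) (hΓ : IsVorticity Γ) :
    vorticityOf π (nrmhKernel Q π Γ) = Γ := by
  ext x y
  rw [vorticityOf_apply]
  by_cases h : y = x
  · subst h; rw [sub_self, hΓ.diag]
  · rw [nrmhKernel_of_ne h, nrmhKernel_of_ne (Ne.symm h), mul_nrmhRate hπ, mul_nrmhRate hπ,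
      hΓ.1 x y]
    have e : min (π x * Q x y) (Γ x y + π y * Q y x) - Γ x y =
        min (π y * Q y x) (-Γ x y + π x * Q x y) := by
      rw [← min_sub_sub_right, min_comm]
      congr 1 <;> ring
    linarith [e]

/-- **THEOREM 2.5 (invariance)**: `π` is invariant for `P_Γ` — from Lemma 2.4 and `Γ1 = 0`
(Lemma 2.1 (iii)); only `π > 0` and `Γ` a vorticity matrix are used. [cite: Bierkens2015, §2.3
Theorem 2.5] -/
theorem nrmhKernel_isStationary (hπ : ∀ x, 0 < π x) (hΓ : IsVorticity Γ) :
    IsStationary π (nrmhKernel Q π Γ) := by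
  intro y
  have hcol := hΓ.colSum y
  rw [← vorticityOf_nrmhKernel (Q := Q) hπ hΓ] at hcol
  simp only [vorticityOf_apply, sum_sub_distrib, ← mul_sum, nrmhKernel_rowSum, mul_one] at hcol
  linarith

/-- **THEOREM 2.5** as printed: for a compatible combination (`Q` stochastic, `Γ` a vorticity
matrix, `π > 0`, vorticity bound) `P_Γ` is a stochastic matrix with invariant distribution `π` and
vorticity `Γ`. [cite: Bierkens2015, §2.3 Theorem 2.5] -/
theorem Bierkens2015_thm_2_5 (hπ : ∀ x, 0 < π x) (hQ : IsRowStochastic Q) (hΓ : IsVorticity Γ)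
    (hbound : ∀ x y, -(π y * Q y x) ≤ Γ x y) :
    IsRowStochastic (nrmhKernel Q π Γ) ∧ IsStationary π (nrmhKernel Q π Γ) ∧
      vorticityOf π (nrmhKernel Q π Γ) = Γ :=
  ⟨nrmhKernel_isRowStochastic hπ hQ hbound, nrmhKernel_isStationary hπ hΓ,
    vorticityOf_nrmhKernel hπ hΓ⟩

/-- `P_Γ` is reversible iff `Γ = 0` (Lemma 2.1 (ii) with Lemma 2.4). [cite: Bierkens2015, §2.1
Lemma 2.1 (ii), §2.3 Lemma 2.4] -/
theorem nrmhKernel_detailedBalance_iff (hπ : ∀ x, 0 < π x) (hΓ : IsVorticity Γ) :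
    DetailedBalance π (nrmhKernel Q π Γ) ↔ Γ = 0 := by
  rw [← vorticityOf_eq_zero_iff, vorticityOf_nrmhKernel hπ hΓ]

/-- **PROPOSITION 2.8** ("every Markov chain may be built … by the described procedure"): with
`Q = P` and `Γ` the vorticity of `(P, π)`, `P_Γ = P`. [cite: Bierkens2015, §2.4 Prop. 2.8] -/
theorem nrmhKernel_self_vorticityOf (hπ : ∀ x, 0 < π x) {P : Matrix X X ℝ} (hP : IsRowStochastic P) :
    nrmhKernel P π (vorticityOf π P) = P := by
  have hrate : ∀ x y, nrmhRate P π (vorticityOf π P) x y = P x y := by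
    intro x y
    rw [nrmhRate, vorticityOf_apply, sub_add_cancel, mul_comm, mul_div_assoc, div_self (hπ x).ne',
      mul_one, min_self]
  ext x y
  by_cases h : y = x
  · subst h
    rw [nrmhKernel_self]
    have := hP.2 y
    rw [← add_sum_erase _ _ (mem_univ y)] at this
    rw [sum_congr rfl fun z _ => hrate y z]
    linarith
  · rw [nrmhKernel_of_ne h, hrate]

/-- **PROPOSITION 2.10**: NRMH with proposal `Q = H + Γ/(2π)` (the tree's `addVorticity H π Γ`) and
vorticity `Γ` IS the chain `K + Γ/(2π)` with `K` the classical Metropolis–Hastings kernel of `H`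
("`π(x)P₁(x,y) = min(π(x)Q(x,y), Γ(x,y) + π(y)Q(y,x)) = … = π(x)P₂(x,y)`"); only `π > 0` and `Γ` a
vorticity matrix are used. [cite: Bierkens2015, §2.4 Prop. 2.10] -/
theorem nrmhKernel_addVorticity (hπ : ∀ x, 0 < π x) (hΓ : IsVorticity Γ) (H : Matrix X X ℝ) :
    nrmhKernel (addVorticity H π Γ) π Γ = addVorticity (Matrix.of (mhKernel H π)) π Γ := by
  have hrate : ∀ x y, nrmhRate (addVorticity H π Γ) π Γ x y = mhRate H π x y + Γ x y / (2 * π x) := by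
    intro x y
    have hx := (hπ x).ne'
    have hy := (hπ y).ne'
    have e1 : π x * nrmhRate (addVorticity H π Γ) π Γ x y =
        Γ x y / 2 + min (π x * H x y) (π y * H y x) := by
      rw [mul_nrmhRate hπ, addVorticity_apply, addVorticity_apply, hΓ.1 x y, ← min_add_add_left]
      congr 1
      · field_simp; ring
      · field_simp; ring
    have e2 : π x * (mhRate H π x y + Γ x y / (2 * π x)) =
        Γ x y / 2 + min (π x * H x y) (π y * H y x) := by
      rw [mul_add, mul_mhRate hπ]; field_simp; ring
    exact mul_left_cancel₀ hx (e1.trans e2.symm)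
  ext x y
  by_cases h : y = x
  · subst h
    rw [nrmhKernel_self, addVorticity_apply, Matrix.of_apply, mhKernel_self, hΓ.diag, zero_div,
      add_zero, sum_congr rfl fun z _ => hrate y z, sum_add_distrib]
    have hΓsum : ∑ z ∈ univ.erase y, Γ y z / (2 * π y) = 0 := by
      rw [← sum_div, sum_erase_eq_sub (mem_univ y), hΓ.2 y, hΓ.diag, sub_zero, zero_div]
    rw [hΓsum]; ring
  · rw [nrmhKernel_of_ne h, addVorticity_apply, Matrix.of_apply, mhKernel_of_ne h, hrate]

end NRMH

end Literature.Probability.MarkovChains
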